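import Summits.BirchSwinnertonDyer.BirchSwinnertonDyer.Theorems.SoloInformedHeightPencil

/-!
# SoloInformedNullPlane — at rank two the two-slope radical is a NULL PLANE of the pencil

`SoloInformedHeightPencil` reduced excess rank `rank E(ℚ) > r_an = r` (granted the two slope
identities `(ZZ_r)_α`, `(ZZ_r)_β` and the two Kato divisibilities) to the RADICAL CONDITION `(R_αβ)_p`
at every good ordinary `p`: the Gram matrix `B = [⟨Pᵢ,Pⱼ⟩_{D₁}]` of ONE member of the pencil
`D₁ - s·ℓ⊗ℓ` (`ℓ = log_ω`) on the Gross–Zagier family `P` has a non-zero kernel vector inside the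
hyperplane `Σ xᵢ ℓ(Pᵢ) = 0`; `SoloInformedRadicalMotivic` showed the condition is normalisation-free.

This file gives the condition its final shape in the first open case `r = 2`, where the hyperplane
`ker(x ↦ Σ xᵢ ℓ(Pᵢ))` is a LINE, so one radical vector is the whole hyperplane:

* `soloInformedNull_eq_smul_vecMulVec_of_ker` (general `ι`): a symmetric `B` that kills the
  hyperplane `v·x = 0` (`v ≠ 0`) is a multiple of `v vᵀ`: `B = μ·v vᵀ`. Proof: feeding the vectors
  `vᵢ₀·eⱼ - vⱼ·eᵢ₀` gives `vᵢ₀ Bᵢⱼ = vⱼ Bᵢᵢ₀`; with symmetry `Bᵢⱼ = (Bᵢ₀ᵢ₀ / vᵢ₀²)·vᵢ vⱼ`.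
* `soloInformedNull_fin_two` (`ι = Fin 2`): ONE non-zero common radical vector (`B x = 0`,
  `v·x = 0`) already forces `B = μ·v vᵀ`; conversely (`soloInformedNull_fin_two_radical_of_eq`)
  `x = (v₁, -v₀)` is then a common radical vector. Hence every member `B - s·v vᵀ = (μ - s)·v vᵀ`
  of the pencil has rank `≤ 1`, and exactly one member (`s = μ`) vanishes identically
  (`soloInformedNull_member_eq_zero_iff`).
* HEIGHT-DATA FORM (`soloInformedNull_pencil_fin_two_iff`): for two distinct pencil members `D₁`,
  `D₂ = D₁ - t·ℓ⊗ℓ` (`t ≠ 0`) and a pair `P = (P₀, P₁)` with `(ℓ(P₀), ℓ(P₁)) ≠ 0`: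
  `Reg_{D₁}(P) = 0 ∧ Reg_{D₂}(P) = 0 ↔ ∃ μ, ⟨Pᵢ,Pⱼ⟩_{D₁} = μ·ℓ(Pᵢ)·ℓ(Pⱼ) (i, j ∈ {0,1})`, i.e. the
  height `D₁` restricted to the plane `Π = ℤP₀ + ℤP₁` IS `μ·ℓ⊗ℓ`; equivalently
  (`soloInformedNull_quadratic_const`) the normalised height `Q ↦ ĥ_{D₁}(Q)/ℓ(Q)²` is CONSTANT `= μ`
  on `Π`; equivalently (`soloInformedNull_minor_criterion`) BOTH numbers
  `ℓ(P₀)·⟨P₁,Pⱼ⟩_{D₁} - ℓ(P₁)·⟨P₀,Pⱼ⟩_{D₁}` (`j = 0, 1`) vanish.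
* The rank-two certificate (one non-zero minor at one ordinary `p` ⇒ `rank E(ℚ) = 2`) and the
  excess-rank reading (`ĥ_p = μ_p·log_ω²` on a rank-two lattice at EVERY ordinary `p`) are in
  `SoloInformedNullPlaneRank`.

Reading for the summit (`BirchSwinnertonDyer`, documentation only). `ĥ_p(Q)` and `log_ω(Q)²` are
the two weight-two `p`-adic periods of the point `Q` (Mazur–Tate: `ĥ_p = log_p ∘ σ_p`-part plus
finite-prime intersection numbers; `log_ω` = the formal logarithm); `(R_αβ)_p` at `r = 2` is thus
the statement that the `p`-adic sigma function and the square of the formal logarithm are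
PROPORTIONAL along a rank-two lattice of rational points — one quadratic relation among `p`-adic
periods of the 1-motive `[ℤ² → E]`, outside the (linear) range of the `p`-adic analytic subgroup
theorem and strictly beyond Schneider's method in two variables (parameter count `4 > 6` needed in
Waldschmidt's direct-factor weights for the non-split `𝒢_P`; `4 > 4` only in the split-weight
accounting; see the docstring of `SoloInformedRadicalMotivic`). Nothing in this file asserts a
conjecture or constructs a height: `B`, `v`, `D₁`, `D₂`, `ℓ`, `t`, `μ` are parameters.
-/

noncomputable section

open scoped Classical MatrixGroups ModularForm

open CongruenceSubgroup Literature.NumberTheory.EllipticCurves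
  Literature.NumberTheory.EllipticCurves.ModularForms WeierstrassCurve WeierstrassCurve.Affine.Point
  Matrix

namespace Summit.BirchSwinnertonDyer.BirchSwinnertonDyer.Theorems

/-! ### A symmetric matrix killing a hyperplane is a multiple of `v vᵀ` -/

section LinearAlgebra

variable {ι : Type*} [Fintype ι] {K : Type*} [Field K]

/-- `(μ·v wᵀ) x = μ (w·x) v`. [folklore] -/
theorem soloInformedNull_smul_vecMulVec_mulVec (μ : K) (v w x : ι → K) :
    (μ • vecMulVec v w) *ᵥ x = (μ * (w ⬝ᵥ x)) • v := by
  ext i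
  simp only [Matrix.mulVec, dotProduct, Matrix.smul_apply, vecMulVec_apply, smul_eq_mul,
    Pi.smul_apply, Finset.mul_sum, Finset.sum_mul]
  exact Finset.sum_congr rfl fun j _ => by ring

/-- A multiple of `v vᵀ` kills the hyperplane `v·x = 0`. [folklore] -/
theorem soloInformedNull_mulVec_eq_zero_of_eq {B : Matrix ι ι K} {v : ι → K} {μ : K}
    (hB : B = μ • vecMulVec v v) {x : ι → K} (hvx : v ⬝ᵥ x = 0) : B *ᵥ x = 0 := by
  rw [hB, soloInformedNull_smul_vecMulVec_mulVec, hvx, mul_zero, zero_smul]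

/-- Entry relation: if `B` kills the hyperplane `v·x = 0` then `vᵢ₀·Bᵢⱼ = vⱼ·Bᵢᵢ₀` (feed the vector
`vᵢ₀·eⱼ - vⱼ·eᵢ₀`). [folklore] -/
theorem soloInformedNull_entry_rel (B : Matrix ι ι K) {v : ι → K}
    (hker : ∀ x : ι → K, v ⬝ᵥ x = 0 → B *ᵥ x = 0) (i₀ i j : ι) :
    v i₀ * B i j = v j * B i i₀ := by
  classical
  have hx : v ⬝ᵥ (v i₀ • Pi.single j (1 : K) - v j • Pi.single i₀ (1 : K)) = 0 := by
    rw [dotProduct_sub, dotProduct_smul, dotProduct_smul, dotProduct_single_one,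
      dotProduct_single_one, smul_eq_mul, smul_eq_mul]
    ring
  have h := congr_fun (hker _ hx) i
  rw [Matrix.mulVec_sub, Matrix.mulVec_smul, Matrix.mulVec_smul, Matrix.mulVec_single_one,
    Matrix.mulVec_single_one] at h
  simp only [Pi.sub_apply, Pi.smul_apply, smul_eq_mul, Matrix.col_apply, Pi.zero_apply] at h
  linear_combination h

/-- **Null-hyperplane lemma.** A SYMMETRIC matrix `B` over a field which kills the hyperplane
`{x | v·x = 0}` of a non-zero vector `v` is a multiple of `v vᵀ`. [folklore] -/
theorem soloInformedNull_eq_smul_vecMulVec_of_ker (B : Matrix ι ι K) (hB : Bᵀ = B) {v : ι → K}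
    (hv : v ≠ 0) (hker : ∀ x : ι → K, v ⬝ᵥ x = 0 → B *ᵥ x = 0) :
    ∃ μ : K, B = μ • vecMulVec v v := by
  obtain ⟨i₀, hi₀⟩ := Function.ne_iff.mp hv
  have hi₀ : v i₀ ≠ 0 := hi₀
  refine ⟨B i₀ i₀ / v i₀ ^ 2, ?_⟩
  ext i j
  have h1 := soloInformedNull_entry_rel B hker i₀ i j
  have h2 := soloInformedNull_entry_rel B hker i₀ i₀ i
  have hsym : B i i₀ = B i₀ i := Matrix.IsSymm.apply (A := B) hB i₀ i
  have key : v i₀ ^ 2 * B i j = B i₀ i₀ * (v i * v j) := by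
    rw [hsym] at h1
    linear_combination v i₀ * h1 + v j * h2
  rw [Matrix.smul_apply, vecMulVec_apply, smul_eq_mul, div_mul_eq_mul_div,
    eq_div_iff (pow_ne_zero 2 hi₀)]
  linear_combination key

/-- Iff form. [folklore] -/
theorem soloInformedNull_ker_iff (B : Matrix ι ι K) (hB : Bᵀ = B) {v : ι → K} (hv : v ≠ 0) :
    (∀ x : ι → K, v ⬝ᵥ x = 0 → B *ᵥ x = 0) ↔ ∃ μ : K, B = μ • vecMulVec v v :=
  ⟨soloInformedNull_eq_smul_vecMulVec_of_ker B hB hv,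
    fun ⟨_, hμ⟩ _ hvx => soloInformedNull_mulVec_eq_zero_of_eq hμ hvx⟩

/-- Then EVERY member of the pencil kills the hyperplane (`B - s·v vᵀ = (μ - s)·v vᵀ` has rank `≤ 1`).
[folklore] -/
theorem soloInformedNull_member_mulVec_eq_zero {B : Matrix ι ι K} {v : ι → K} {μ : K}
    (hB : B = μ • vecMulVec v v) (s : K) {x : ι → K} (hvx : v ⬝ᵥ x = 0) :
    (B - s • vecMulVec v v) *ᵥ x = 0 := by
  rw [hB, ← sub_smul, soloInformedNull_smul_vecMulVec_mulVec, hvx, mul_zero, zero_smul]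

omit [Fintype ι] in
/-- … and exactly ONE member, `s = μ`, vanishes identically. [folklore] -/
theorem soloInformedNull_member_eq_zero_iff {v : ι → K} (hv : v ≠ 0) (μ s : K) :
    μ • vecMulVec v v - s • vecMulVec v v = 0 ↔ s = μ := by
  constructor
  · intro h
    obtain ⟨i₀, hi₀⟩ := Function.ne_iff.mp hv
    have hi₀ : v i₀ ≠ 0 := hi₀
    have h0 := congr_fun (congr_fun h i₀) i₀
    simp only [Matrix.sub_apply, Matrix.smul_apply, vecMulVec_apply, smul_eq_mul,
      Matrix.zero_apply] at h0
    have h1 : (μ - s) * (v i₀ * v i₀) = 0 := by linear_combination h0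
    rcases mul_eq_zero.mp h1 with h2 | h2
    · exact (sub_eq_zero.mp h2).symm
    · exact absurd (mul_self_eq_zero.mp h2) hi₀
  · rintro rfl
    exact sub_self _

/-! #### `ι = Fin 2`: one radical vector is the whole hyperplane -/

/-- In `K²` the hyperplane `v·x = 0` (`v ≠ 0`) is a line: one non-zero common radical vector
makes `B` kill all of it. [folklore] -/
theorem soloInformedNull_fin_two_ker {B : Matrix (Fin 2) (Fin 2) K} {v x : Fin 2 → K} (hv : v ≠ 0)
    (hx : x ≠ 0) (hBx : B *ᵥ x = 0) (hvx : v ⬝ᵥ x = 0) (y : Fin 2 → K) (hvy : v ⬝ᵥ y = 0) :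
    B *ᵥ y = 0 := by
  simp only [dotProduct, Fin.sum_univ_two] at hvx hvy
  have hD : x 0 * y 1 - x 1 * y 0 = 0 := by
    have e0 : v 0 * (x 0 * y 1 - x 1 * y 0) = 0 := by linear_combination (y 1) * hvx - (x 1) * hvy
    have e1 : v 1 * (x 0 * y 1 - x 1 * y 0) = 0 := by
      linear_combination (-(y 0)) * hvx + (x 0) * hvy
    by_contra hD
    apply hv
    funext k
    fin_cases k
    · exact (mul_eq_zero.mp e0).resolve_right hD
    · exact (mul_eq_zero.mp e1).resolve_right hD
  obtain ⟨k, hk⟩ := Function.ne_iff.mp hx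
  have hk : x k ≠ 0 := hk
  have hy : x k • y = y k • x := by
    funext m
    simp only [Pi.smul_apply, smul_eq_mul]
    fin_cases k <;> fin_cases m
    · simp only [Fin.zero_eta]; ring
    · simp only [Fin.zero_eta, Fin.mk_one]; linear_combination hD
    · simp only [Fin.zero_eta, Fin.mk_one]; linear_combination -hD
    · simp only [Fin.mk_one]; ring
  have h : x k • (B *ᵥ y) = 0 := by rw [← Matrix.mulVec_smul, hy, Matrix.mulVec_smul, hBx, smul_zero]
  exact (smul_eq_zero.mp h).resolve_left hk

/-- **Null-plane lemma (`r = 2`).** A symmetric `2 × 2` matrix with a non-zero common radical vector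
(`B x = 0`, `v·x = 0`) for a non-zero `v` is `μ·v vᵀ`. [folklore] -/
theorem soloInformedNull_fin_two (B : Matrix (Fin 2) (Fin 2) K) (hB : Bᵀ = B) {v x : Fin 2 → K}
    (hv : v ≠ 0) (hx : x ≠ 0) (hBx : B *ᵥ x = 0) (hvx : v ⬝ᵥ x = 0) :
    ∃ μ : K, B = μ • vecMulVec v v :=
  soloInformedNull_eq_smul_vecMulVec_of_ker B hB hv (soloInformedNull_fin_two_ker hv hx hBx hvx)

/-- Converse: `x = (v₁, -v₀)` is a non-zero common radical vector of `μ·v vᵀ`. [folklore] -/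
theorem soloInformedNull_fin_two_radical_of_eq {B : Matrix (Fin 2) (Fin 2) K} {v : Fin 2 → K} {μ : K}
    (hv : v ≠ 0) (hB : B = μ • vecMulVec v v) :
    ∃ x : Fin 2 → K, x ≠ 0 ∧ B *ᵥ x = 0 ∧ v ⬝ᵥ x = 0 := by
  have hvx : v ⬝ᵥ ![v 1, -v 0] = 0 := by
    simp only [dotProduct, Fin.sum_univ_two, Matrix.cons_val_zero, Matrix.cons_val_one]
    ring
  refine ⟨![v 1, -v 0], ?_, soloInformedNull_mulVec_eq_zero_of_eq hB hvx, hvx⟩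
  intro h
  apply hv
  have h0 := congr_fun h 0
  have h1 := congr_fun h 1
  simp only [Matrix.cons_val_zero, Matrix.cons_val_one, Pi.zero_apply, neg_eq_zero] at h0 h1
  funext k
  fin_cases k
  · exact h1
  · exact h0

/-- Radical ↔ proportionality at `r = 2`. [folklore] -/
theorem soloInformedNull_fin_two_iff (B : Matrix (Fin 2) (Fin 2) K) (hB : Bᵀ = B) {v : Fin 2 → K}
    (hv : v ≠ 0) :
    (∃ x : Fin 2 → K, x ≠ 0 ∧ B *ᵥ x = 0 ∧ v ⬝ᵥ x = 0) ↔ ∃ μ : K, B = μ • vecMulVec v v :=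
  ⟨fun ⟨_, hx, hBx, hvx⟩ => soloInformedNull_fin_two B hB hv hx hBx hvx,
    fun ⟨_, hμ⟩ => soloInformedNull_fin_two_radical_of_eq hv hμ⟩

/-- MINOR CRITERION: for `v ≠ 0`, `B = μ·v vᵀ` for some `μ` iff the two minors
`v₀·B₁ⱼ - v₁·B₀ⱼ` (`j = 0, 1`) of the `2 × 3` matrix `[v | B]` vanish (then `det B = 0` as well).
[folklore] -/
theorem soloInformedNull_minor_criterion (B : Matrix (Fin 2) (Fin 2) K) (hB : Bᵀ = B)
    {v : Fin 2 → K} (hv : v ≠ 0) :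
    (∃ μ : K, B = μ • vecMulVec v v) ↔ ∀ j, v 0 * B 1 j = v 1 * B 0 j := by
  constructor
  · rintro ⟨μ, rfl⟩ j
    simp only [Matrix.smul_apply, vecMulVec_apply, smul_eq_mul]
    ring
  · intro hmin
    refine soloInformedNull_eq_smul_vecMulVec_of_ker B hB hv fun x hvx => ?_
    simp only [dotProduct, Fin.sum_univ_two] at hvx
    have hsym : B 1 0 = B 0 1 := Matrix.IsSymm.apply (A := B) hB 0 1
    have m0 := hmin 0
    have m1 := hmin 1
    funext i
    simp only [Matrix.mulVec, dotProduct, Fin.sum_univ_two, Pi.zero_apply]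
    -- `v ≠ 0`: one coordinate is non-zero
    by_cases h0 : v 0 = 0
    · have h1 : v 1 ≠ 0 := by
        intro h1; apply hv; funext k; fin_cases k; exacts [h0, h1]
      -- minors with `v 0 = 0`: `v 1 * B 0 j = 0`, so row `0` of `B` vanishes, and `x 1 = 0`
      have hB00 : B 0 0 = 0 := by
        have := m0; rw [h0, zero_mul] at this
        exact (mul_eq_zero.mp this.symm).resolve_left h1
      have hB01 : B 0 1 = 0 := by
        have := m1; rw [h0, zero_mul] at this
        exact (mul_eq_zero.mp this.symm).resolve_left h1
      have hx1 : x 1 = 0 := by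
        rw [h0, zero_mul, zero_add] at hvx
        exact (mul_eq_zero.mp hvx).resolve_left h1
      fin_cases i
      · simp only [Fin.zero_eta]; rw [hB00, hB01]; ring
      · simp only [Fin.mk_one]; rw [hsym, hB01, hx1]; ring
    · -- `v 0 ≠ 0`: `B 1 j = (v 1 / v 0) B 0 j`, and `x 0 = -(v 1 / v 0) x 1`
      fin_cases i
      · simp only [Fin.zero_eta]
        have e : v 0 * (B 0 0 * x 0 + B 0 1 * x 1) = 0 := by
          rw [hsym] at m0
          linear_combination (B 0 0) * hvx + (x 1) * m0
        exact (mul_eq_zero.mp e).resolve_left h0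
      · simp only [Fin.mk_one]
        have e : v 0 * (B 1 0 * x 0 + B 1 1 * x 1) = 0 := by
          rw [hsym]
          linear_combination (B 0 1) * hvx + (x 1) * m1
        exact (mul_eq_zero.mp e).resolve_left h0

end LinearAlgebra

/-! ### Height-data form at `r = 2`: `(R_αβ)_p` says `D₁|_Π = μ·ℓ⊗ℓ` on the Gross–Zagier plane -/

section Pencil

variable {W : WeierstrassCurve ℚ} {p : ℕ} [Fact p.Prime]
  {D₁ D₂ : WeierstrassCurve.PAdicHeightData W p} {ℓ : W.toAffine.Point →+ ℚ_[p]} {t : ℚ_[p]}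

omit [Fact p.Prime] in
/-- Matrix form ↔ entry form of `D₁|_P = μ·ℓ⊗ℓ`. [folklore] -/
theorem soloInformedNull_pairingMatrix_eq_iff [Fact p.Prime] (D₁ : WeierstrassCurve.PAdicHeightData W p)
    (ℓ : W.toAffine.Point →+ ℚ_[p]) {ι : Type*} (P : ι → W.toAffine.Point) (μ : ℚ_[p]) :
    D₁.pairingMatrix P = μ • vecMulVec (fun i => ℓ (P i)) (fun i => ℓ (P i)) ↔
      ∀ i j, D₁.pairing (P i) (P j) = μ * ℓ (P i) * ℓ (P j) := by
  rw [← Matrix.ext_iff]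
  refine forall_congr' fun i => forall_congr' fun j => ?_
  simp only [WeierstrassCurve.PAdicHeightData.pairingMatrix, Matrix.of_apply, Matrix.smul_apply,
    vecMulVec_apply, smul_eq_mul, mul_assoc]

/-- GENERAL FAMILY: the Gram matrix of `D₁` on `P` kills the whole hyperplane `Σ xᵢ ℓ(Pᵢ) = 0`
(`(ℓ(Pᵢ))ᵢ ≠ 0`) iff `⟨Pᵢ,Pⱼ⟩_{D₁} = μ·ℓ(Pᵢ)·ℓ(Pⱼ)` for one constant `μ`. (For `r ≥ 3` this is
STRONGER than the radical condition, which only asks for one kernel LINE in the hyperplane.)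
[folklore] -/
theorem soloInformedNull_pairing_ker_iff (D₁ : WeierstrassCurve.PAdicHeightData W p)
    (ℓ : W.toAffine.Point →+ ℚ_[p]) {ι : Type*} [Fintype ι] (P : ι → W.toAffine.Point)
    (hP : (fun i => ℓ (P i)) ≠ 0) :
    (∀ x : ι → ℚ_[p], (fun i => ℓ (P i)) ⬝ᵥ x = 0 → D₁.pairingMatrix P *ᵥ x = 0) ↔
      ∃ μ : ℚ_[p], ∀ i j, D₁.pairing (P i) (P j) = μ * ℓ (P i) * ℓ (P j) := by
  rw [soloInformedNull_ker_iff _ (D₁.pairingMatrix_transpose P) hP]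
  exact exists_congr fun μ => soloInformedNull_pairingMatrix_eq_iff D₁ ℓ P μ

/-- **`(R_αβ)_p` at `r = 2` is a null plane.** Two distinct pencil members `D₁`, `D₂ = D₁ - t·ℓ⊗ℓ`
(`t ≠ 0`) BOTH have zero Gram determinant on a pair `P = (P₀, P₁)` with `(ℓ(P₀), ℓ(P₁)) ≠ 0` iff
`⟨Pᵢ,Pⱼ⟩_{D₁} = μ·ℓ(Pᵢ)·ℓ(Pⱼ)` (`i, j ∈ {0,1}`) for one constant `μ ∈ ℚ_p`: on the plane spanned by
`P₀, P₁` the height `D₁` IS `μ·ℓ⊗ℓ` (and `D₂` is `(μ - t)·ℓ⊗ℓ`; every member of the pencil has rank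
`≤ 1` there, the member `s = μ` vanishes identically). [folklore] -/
theorem soloInformedNull_pencil_fin_two_iff
    (h : ∀ P Q, D₂.pairing P Q = D₁.pairing P Q - t * ℓ P * ℓ Q) (ht : t ≠ 0)
    (P : Fin 2 → W.toAffine.Point) (hP : (fun i => ℓ (P i)) ≠ 0) :
    (padicRegulatorOf D₁ P = 0 ∧ padicRegulatorOf D₂ P = 0) ↔
      ∃ μ : ℚ_[p], ∀ i j, D₁.pairing (P i) (P j) = μ * ℓ (P i) * ℓ (P j) := by
  constructor
  · rintro ⟨h₁, h₂⟩
    obtain ⟨x, hx, hBx, hvx⟩ := soloInformedPencil_dichotomy h ht P h₁ h₂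
    obtain ⟨μ, hμ⟩ :=
      soloInformedNull_fin_two (D₁.pairingMatrix P) (D₁.pairingMatrix_transpose P) hP hx hBx hvx
    exact ⟨μ, (soloInformedNull_pairingMatrix_eq_iff D₁ ℓ P μ).mp hμ⟩
  · rintro ⟨μ, hμ⟩
    obtain ⟨x, hx, hBx, hvx⟩ := soloInformedNull_fin_two_radical_of_eq hP
      ((soloInformedNull_pairingMatrix_eq_iff D₁ ℓ P μ).mpr hμ)
    exact soloInformedPencil_padicRegulatorOf_eq_zero_of_common_radical h P hx hBx hvx

/-- The second member on the null plane: `⟨Pᵢ,Pⱼ⟩_{D₂} = (μ - t)·ℓ(Pᵢ)·ℓ(Pⱼ)`. [folklore] -/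
theorem soloInformedNull_second_member (h : ∀ P Q, D₂.pairing P Q = D₁.pairing P Q - t * ℓ P * ℓ Q)
    {ι : Type*} (P : ι → W.toAffine.Point) {μ : ℚ_[p]}
    (hμ : ∀ i j, D₁.pairing (P i) (P j) = μ * ℓ (P i) * ℓ (P j)) (i j : ι) :
    D₂.pairing (P i) (P j) = (μ - t) * ℓ (P i) * ℓ (P j) := by
  rw [h, hμ]
  ring

/-- UNIQUE NULL MEMBER: on the null plane the member `D₁ - s·ℓ⊗ℓ` vanishes identically iff `s = μ`.
[folklore] -/
theorem soloInformedNull_member_vanishes_iff {ι : Type*} (P : ι → W.toAffine.Point)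
    (hP : (fun i => ℓ (P i)) ≠ 0) {μ : ℚ_[p]}
    (hμ : ∀ i j, D₁.pairing (P i) (P j) = μ * ℓ (P i) * ℓ (P j)) (s : ℚ_[p]) :
    (∀ i j, D₁.pairing (P i) (P j) - s * ℓ (P i) * ℓ (P j) = 0) ↔ s = μ := by
  constructor
  · intro hs
    obtain ⟨i₀, hi₀⟩ := Function.ne_iff.mp hP
    have hi₀ : ℓ (P i₀) ≠ 0 := hi₀
    have h0 := hs i₀ i₀
    rw [hμ] at h0
    have h1 : (μ - s) * (ℓ (P i₀) * ℓ (P i₀)) = 0 := by linear_combination h0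
    rcases mul_eq_zero.mp h1 with h2 | h2
    · exact (sub_eq_zero.mp h2).symm
    · exact absurd (mul_self_eq_zero.mp h2) hi₀
  · rintro rfl i j
    rw [hμ, sub_self]

/-- `⟨nP, Q⟩ = n·⟨P, Q⟩`. [folklore] -/
theorem soloInformedNull_pairing_zsmul_left (D : WeierstrassCurve.PAdicHeightData W p) (n : ℤ)
    (P Q : W.toAffine.Point) : D.pairing (n • P) Q = (n : ℚ_[p]) * D.pairing P Q := by
  rw [D.symm, map_zsmul, zsmul_eq_mul, D.symm]

/-- `⟨P, nQ⟩ = n·⟨P, Q⟩`. [folklore] -/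
theorem soloInformedNull_pairing_zsmul_right (D : WeierstrassCurve.PAdicHeightData W p) (n : ℤ)
    (P Q : W.toAffine.Point) : D.pairing P (n • Q) = (n : ℚ_[p]) * D.pairing P Q := by
  rw [map_zsmul, zsmul_eq_mul]

/-- Expansion of `ĥ_D(aP₀ + bP₁)`. [folklore] -/
theorem soloInformedNull_pairing_comb (D : WeierstrassCurve.PAdicHeightData W p) (a b : ℤ)
    (P₀ P₁ : W.toAffine.Point) :
    D.pairing (a • P₀ + b • P₁) (a • P₀ + b • P₁) =
      (a : ℚ_[p]) ^ 2 * D.pairing P₀ P₀ + 2 * a * b * D.pairing P₀ P₁ +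
        (b : ℚ_[p]) ^ 2 * D.pairing P₁ P₁ := by
  simp only [map_add, AddMonoidHom.add_apply, soloInformedNull_pairing_zsmul_left,
    soloInformedNull_pairing_zsmul_right, D.symm P₁ P₀]
  ring

/-- **The normalised height is constant on the null plane.** If `⟨Pᵢ,Pⱼ⟩_{D₁} = μ·ℓ(Pᵢ)·ℓ(Pⱼ)` on
the pair `P` then `ĥ_{D₁}(Q) = μ·ℓ(Q)²` for every `Q = aP₀ + bP₁` (`a, b ∈ ℤ`): the function
`Q ↦ ĥ_{D₁}(Q)/ℓ(Q)²` is CONSTANT `= μ` on the lattice `ℤP₀ + ℤP₁` (off `ker ℓ`). For the canonical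
height and `ℓ = log_ω`: `ĥ_p(Q)/log_ω(Q)² = μ_p` on a rank-two sublattice of `E(ℚ)`. [folklore] -/
theorem soloInformedNull_quadratic_const (P : Fin 2 → W.toAffine.Point) {μ : ℚ_[p]}
    (hμ : ∀ i j, D₁.pairing (P i) (P j) = μ * ℓ (P i) * ℓ (P j)) (a b : ℤ) :
    D₁.pairing (a • P 0 + b • P 1) (a • P 0 + b • P 1) = μ * ℓ (a • P 0 + b • P 1) ^ 2 := by
  rw [soloInformedNull_pairing_comb, hμ 0 0, hμ 0 1, hμ 1 1, map_add, map_zsmul, map_zsmul,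
    zsmul_eq_mul, zsmul_eq_mul]
  ring

/-- Conversely (polarisation, `char ℚ_p = 0`): if `ĥ_{D₁}(Q) = μ·ℓ(Q)²` for `Q = P₀, P₁, P₀ + P₁`
then `⟨Pᵢ,Pⱼ⟩_{D₁} = μ·ℓ(Pᵢ)·ℓ(Pⱼ)` for all `i, j`. [folklore] -/
theorem soloInformedNull_of_quadratic (P : Fin 2 → W.toAffine.Point) {μ : ℚ_[p]}
    (h0 : D₁.pairing (P 0) (P 0) = μ * ℓ (P 0) ^ 2) (h1 : D₁.pairing (P 1) (P 1) = μ * ℓ (P 1) ^ 2)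
    (h01 : D₁.pairing (P 0 + P 1) (P 0 + P 1) = μ * ℓ (P 0 + P 1) ^ 2) :
    ∀ i j, D₁.pairing (P i) (P j) = μ * ℓ (P i) * ℓ (P j) := by
  simp only [map_add, AddMonoidHom.add_apply, D₁.symm (P 1) (P 0), h0, h1] at h01
  have hx : D₁.pairing (P 0) (P 1) = μ * ℓ (P 0) * ℓ (P 1) := by
    have h2 : (2 : ℚ_[p]) * (D₁.pairing (P 0) (P 1) - μ * ℓ (P 0) * ℓ (P 1)) = 0 := by
      linear_combination h01
    exact sub_eq_zero.mp ((mul_eq_zero.mp h2).resolve_left two_ne_zero)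
  intro i j
  fin_cases i <;> fin_cases j
  · simp only [Fin.zero_eta]; rw [h0]; ring
  · simp only [Fin.zero_eta, Fin.mk_one]; exact hx
  · simp only [Fin.zero_eta, Fin.mk_one]; rw [D₁.symm, hx]; ring
  · simp only [Fin.mk_one]; rw [h1]; ring

/-- MINOR CRITERION, height-data form: for `(ℓ(P₀), ℓ(P₁)) ≠ 0`, both Gram determinants vanish iff
both numbers `ℓ(P₀)·⟨P₁,Pⱼ⟩_{D₁} - ℓ(P₁)·⟨P₀,Pⱼ⟩_{D₁}` (`j = 0, 1`) vanish. [folklore] -/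
theorem soloInformedNull_pencil_minor_iff
    (h : ∀ P Q, D₂.pairing P Q = D₁.pairing P Q - t * ℓ P * ℓ Q) (ht : t ≠ 0)
    (P : Fin 2 → W.toAffine.Point) (hP : (fun i => ℓ (P i)) ≠ 0) :
    (padicRegulatorOf D₁ P = 0 ∧ padicRegulatorOf D₂ P = 0) ↔
      ∀ j, ℓ (P 0) * D₁.pairing (P 1) (P j) = ℓ (P 1) * D₁.pairing (P 0) (P j) := by
  rw [soloInformedNull_pencil_fin_two_iff h ht P hP]
  have key := soloInformedNull_minor_criterion (D₁.pairingMatrix P) (D₁.pairingMatrix_transpose P) hP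
  simp only [soloInformedNull_pairingMatrix_eq_iff] at key
  exact key

end Pencil

end Summit.BirchSwinnertonDyer.BirchSwinnertonDyer.Theorems

end
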